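import Mathlib
import HarnessLib
import HarnessLib.Audit
import Summits.AtomisticToContinuum.Statement
import Literature.MathematicalPhysics.QuantumManyBody.PeriodicBoseGas
import Summits.AtomisticToContinuum.BoseEinsteinCondensation.Theorems.BECInfraredBoundAssembly
import Literature.LinearAlgebra.Matrix.InverseMMatrix
import Summits.AtomisticToContinuum.BoseEinsteinCondensation.Theorems.BECInfraredBoundBecFreeGas
import HarnessLib.Audit.Status.Attr

/-!
Route: BECStoquasticCensoring

DORMANT since 2026-08-25T13:23:57Z (reconciler: no traction for 7.7 d (last activity item-evidence-added at 2026-08-17T19:15:47Z); parked, not closed — `ledger route dormant route-AtomisticToContinuum-BECStoquasticCensoring --off` to re) — unstaffed, not closed; items shared with open routes are served there. `ledger route dormant <id> --off` reactivates.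

# Route BECStoquasticCensoring — censor the ground-state walk to (slowly growing) cell windows, push
forward to a positive current law, then Villain long-range order

It suffices to show X = X_B1 (stmt-AtomisticToContinuum-0686, decl ZeroModeOccupation): for every
repulsive finite-range v, at all
small densities, for all large N and some δ > 0, every δ-near-minimiser of the Dirichlet N-body
energy in the box of side (N/ρ)^(1/3)
occupies the normalised constant mode φ₀ = L^(-3/2)·1_box macroscopically, ⟨φ₀, γ_Ψ φ₀⟩ ≥ cN; X_B1 →
BoseEinsteinCondensation is the
PROVED `AtomisticToContinuum.BECInfraredBound.bec_of_zeroMode`. This route (card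
censor-dont-project-mmatrix-flow) reaches X_B1 as
VillainCurrentLRO ∧ CellCountTailsU ∧ CountViolationGapU ∧ CellCondensationGrowing ∧
CensoredTransfer (route-repair 2026-08-16 after the
refuted-misstated verdict on the fixed-(K,M) body of CensoredTransfer, stmt-14636, now restated 1:1:
at FIXED cell size the all-cells window set is exponentially rare in
the number of cells, so the cells must grow with N — K(N) ≍ (log N)^(1/3) — which the K-uniform
retypings …U license and for which in-cell
condensation is no longer a printed theorem but the new crux CellCondensationGrowing; second repair
2026-08-16 after the
refuted-misstated verdicts on CellCountTailsU stmt-14703 / CountViolationGapU stmt-14702 — the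
uncapped prefix `∀ K ≥ K₀, 3ℓ ≤ L` admitted
cells comparable to the box, whose mean count the Dirichlet wall layer displaces from the nominal
window centre ρℓ³ by ≍ N^(1/6) window
units — so both U items are now K-uniform exactly on K₀ ≤ K ≤ log N, the cap CellCondensationGrowing
already carries and all the transfer
uses, with their constants C, c₁, c₀ chosen after ρ; the free-gas branch, v a.e. zero on (0,∞), is
the support lemma FreeGasZeroMode inside
CensoredTransfer): CENSOR, DON'T PROJECT —
restrict (trace) the reversible ground-state diffusion of Ψ₀² to the window set of configurations in
which every interior cell of side
ℓ(N) = K(N)(ρa)^(-1/2) holds ρℓ³ ± M(N)√(ρℓ³) particles, M(N)² ≍ log N ≤ ρℓ³; configuration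
elimination keeps H − E₀ inside the cone of
positive-semidefinite Z-matrices / Dirichlet forms (support StoquasticSchurComplement: positivity
and exactness of the restricted ground
state are theorems, not bets), so the coarse cell-count/face-current law is POSITIVE by construction
and the difficulty is relocated into
three typed inputs about the Dirichlet gas — the stationary mass of the censored set
(CellCountTailsU), the exit rate from it
(CountViolationGapU = bottom of the part form) and local condensation at the poly-log mesoscale
(CellCondensationGrowing) — plus the bet
CensoredTransfer (quasi-locality of the censored kernel, matching to the (3+1)-D Villain engine
VillainCurrentLRO shared with card
vortex-sheet-duality, block coherence ⇒ zero mode). The fixed-K forms CountViolationGap /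
CellCountTails stay as support — restated
2026-08-16 with ρ₀ before K and constants after ρ so that the repaired U items imply them
(Sketch.lean): milestones and refutation proxies.
Lean: `∀ v : ℝ → ENNReal,
Literature.MathematicalPhysics.QuantumManyBody.BoseGas.IsRepulsiveFiniteRange v → ∃ ρ₀ : ℝ, 0 < ρ₀ ∧
∀ ρ : ℝ, 0 < ρ → ρ < ρ₀ → ∃ c : ℝ, 0 < c ∧ ∀ᶠ N : ℕ in Filter.atTop, ∃ δ : ENNReal, 0 < δ ∧ ∀ Ψ :
Literature.MathematicalPhysics.QuantumManyBody.BoseGas.TrialState N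
(Literature.MathematicalPhysics.QuantumManyBody.BoseGas.sideLength ρ N),
Literature.MathematicalPhysics.QuantumManyBody.BoseGas.energy v Ψ ≤
Literature.MathematicalPhysics.QuantumManyBody.BoseGas.groundStateEnergy v N
(Literature.MathematicalPhysics.QuantumManyBody.BoseGas.sideLength ρ N) + δ → ENNReal.ofReal (c * N)
≤ Literature.MathematicalPhysics.QuantumManyBody.BoseGas.occupation N
((Literature.MathematicalPhysics.QuantumManyBody.BoseGas.box
(Literature.MathematicalPhysics.QuantumManyBody.BoseGas.sideLength ρ N)).indicator fun _ =>
((Real.sqrt (Literature.MathematicalPhysics.QuantumManyBody.BoseGas.sideLength ρ N ^ 3))⁻¹ : ℂ))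
Ψ.ψ`

## Assembly
Pure logic plus one PROVED cone fact (glue.lean; unchanged by the 2026-08-16 restatements, which
keep every decl NAME — `closes'` over the
repaired bodies in this seat's Sketch.lean, lean check rc 0, 0 sorries, axioms
propext/Classical.choice/Quot.sound), crux-only hypotheses:
`theorem closes (hE : VillainCurrentLRO) (hT : CellCountTailsU) (hG : CountViolationGapU) (hC :
CellCondensationGrowing) (hR : CensoredTransfer) :
_root_.BoseEinsteinCondensation := AtomisticToContinuum.BECInfraredBound.bec_of_zeroMode (hR hE hT
hG hC)` — the restated transfer bet fed
the engine, the two K-uniform censoring inputs and mesoscale local condensation IS the target X_B1 =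
ZeroModeOccupation by name (for every
repulsive finite-range v; its a.e.-zero branch is the free Dirichlet gas, the support lemma
FreeGasZeroMode = stmt-AtomisticToContinuum-8912),
and X_B1 → BoseEinsteinCondensation (the sub-problem Statement abbrev, by name) is the proved
zero-mode criterion `bec_of_zeroMode`
(occupation_le_maxOccupation + le_condensateNumber). ZeroModeOccupation (target) and the supports
CountViolationGap, CellCountTails,
HomogeneousVillainLRO, ScatteringLengthPos, StoquasticSchurComplement, FreeGasZeroMode are not
hypotheses of `closes` (target = what
CensoredTransfer concludes; the supports are milestones / lemmas for the engine and the transfer);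
Assembly = VillainCurrentLRO →
CellCountTailsU → CountViolationGapU → CellCondensationGrowing → CensoredTransfer →
BoseEinsteinCondensation, `assembly_holds := closes`.

Rationale: WHY THIS LINE. Every blocking card on file (vortex-sheet-duality, integer-block-rotor-rp,
popov-polar-blocking-irrelevant-rg) integrates out MODE spans by
Feshbach–Schur and then bets that the effective world-line weights stay positive — the step the
barrier sources single out (Benfatto1994:
"complex gaussian measures, instead of positive"; BFKT2017: large fields open). Eliminating
CONFIGURATIONS instead cannot leave the cone: the
Schur complement of the irreducible singular M-matrix H − E₀ onto any configuration subset is again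
a positive-semidefinite Z-matrix with
kernel Ψ₀ restricted (Meyer1989 stochastic complement; BermanPlemmons1994 Ch. 6; continuum: the
trace Dirichlet form / time change of the
ground-state diffusion, ChenFukushima2011 Ch. 5; perturbative shadow BravyiEtAl2008), so large
fields are quarantined with exact, sign-free
bookkeeping and return only as a positive jump kernel whose size is a ground-state probability times
a local relaxation rate. Imported
areas: Markov-chain aggregation / M-matrix theory (Meyer1989, Kron reduction DorflerBullo2013,
sparsified Schur complements
KyngSachdeva2016), Dirichlet-form trace theory, and abelian duality/Peierls for Villain currents
(FrohlichSpencerCMP1982, Guth1980,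
KennedyKing1986). ROUTE-REPAIR 2026-08-16
(refuted-misstated CensoredTransfer, refuters rattack-14636 gen 1/2): censoring ALL cells at a FIXED
cell size is self-defeating — with
n_c ≈ N/n̄ cells and an N-independent per-cell violation probability p the window set has mass ≈
e^(−n_c p) → 0 and excursions merge beyond
N* ≈ n̄/p — so the cells now GROW with N, K(N) ≍ ((ρa³)^(1/2) log N / c₁)^(1/3), M(N)² ≍ (2/c₁) log
N: the censoring inputs are retyped
K-UNIFORMLY (CellCountTailsU, CountViolationGapU; natural, since Δ²/2χ_Q = 4πaρM² is K-free and
larger cells fluctuate less) and the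
in-cell coherence that identifies the Josephson couplings, formerly "the proved Fournais2020/LSSY
Thm 5.1 input at ℓ ≤ ℓ_Fournais", becomes
the honest new crux CellCondensationGrowing (local condensation up to ℓ = (log N)(ρa)^(−1/2)),
squarely behind KineticGapLengthScales and
conceded there. ROUTE-REPAIR #2 2026-08-16 (refuted-misstated CellCountTailsU stmt-14703 and
CountViolationGapU stmt-14702; refuters
rattack-14703/14702/14713, GP-level witnesses, no Lean ¬S possible): the U prefix `∀ K ≥ K₀, 3ℓ ≤ L`
reached the macroscopic central cell
ℓ = L/3 while the window is centred at the NOMINAL count ρℓ³; the Dirichlet wall layer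
(ψ₀tanh(d/√2ξ), PethickSmith2008 §6.4 (6.65)) pushes
D ≈ 6√2ξρL² = Θ(N^(2/3)) particles inward and shifts E N_Q there by ≍ N^(1/6) window units (tails
impossible; the gap dies by an IMS cutoff of
Ψ₀ in the smoothed count, excess O(aρ/shift²) → 0 via the ground-state transform), and at fixed K₀
the wall-adjacent cell carries a
ρ-independent relative GP deficit b(K₀) ≈ (0.56/K₀)e^(−7.09K₀) of n̄ → ∞ particles as ρ → 0 (formal:
ρa³ ≲ 10⁻⁴⁹ at K₀ = 4) that no constant
fixed before ρ survives. Repair = the refuters' C′: the cap K ≤ log N (pre-named under KILL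
CRITERIA; the transfer never used more) and
constants after ρ — applied to BOTH U items and, in fixed-K form, to the two supports (the ρ → 0
wall witness bites every
constants-before-ρ variant, fixed-K included; this seat's extension of rattack-14703's witness (ii)
to the gap items). What no prior route does: positivity of the coarse current law is a theorem, the
cell-scale inputs are typed refutable statements
about the Dirichlet gas, and after the repair the line is an EXPONENTIAL SCALE REDUCTION — BEC at
scale N^(1/3) from local condensation at
scale ≤ log N plus two local large-deviation/variational inputs and a Literature-grade engine.
Negatives index: BECSwapAffinity.SwapJensen and BECPopovBerryRG.BerryStiffPhaseLRO
(an n-dependent Villain sandwich refuted by parity modulation — why EngineDeliveredClass below is a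
perturbation CLASS), unrelated to the new items.

RANKED CRUXES. #0 ZeroModeOccupation (target) — X_B1 verbatim (stmt-0686, shared with
BECInfraredBound and others): at small density, for all large N, every δ-near-minimiser of the
Dirichlet energy in the box of side L = (N/ρ)^(1/3) has ⟨φ₀, γ_Ψ φ₀⟩ ≥ cN, φ₀ = L^(-3/2)·1_box. (why
it might fail: thermodynamic-limit BEC in zero-mode Dirichlet form, LSSY2005 Ch. 5, open; fails only
if near-minimisers condense into a mode asymptotically orthogonal to φ₀.) [LSSY2005,
PenroseOnsager1956, Fournais2020]
#2 VillainCurrentLRO (crux) — ENGINE (= stmt-3526, card K3 = vortex-sheet-duality B2;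
Literature-grade, independent of the Bose gas): for every inhomogeneity ratio Λ ≥ 1 there are K₀, c
> 0 such that for all lattice sizes M, T, all direction-wise stiffness floors K_i ≥ K₀ (i ∈ Fin 4)
and every bond field κ with K_i ≤ κ_(x,i) ≤ ΛK_i, the Villain integer-current model on (ℤ/(M+1))³ ×
ℤ/(T+1) has Σ_(x,y) Z(δ_(x,0) − δ_(y,0)) ≥ c(M+1)⁶ Z(0) (uniform equal-time worm long-range order).
Uniformity in M and in the stiffness floor is exactly what the growing-cell transfer consumes
(coarse lattice (L/ℓ(N))³ × T, stiffness K_stiff(N) → ∞). [difficulty: L] (why it might fail: low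
risk, reducible — Villain two-point functions are monotone in every edge coupling (AizenmanEtAl2021
Cor. 11.4), so everything compares down to homogeneous 3-D Villain LRO at one stiffness
(FrohlichSpencerCMP1982, KennedyKing1986); unprinted: odd-tori bookkeeping.) [AizenmanEtAl2021,
DarioGarban2025, FrohlichSpencerCMP1982, KennedyKing1986, FrohlichSimonSpencer1976,
GarbanSpencer2022]
#3 CountViolationGapU (crux; RESTATED 2026-08-16 in repair #2 = the refuters' CountViolationGapLog
cap + ∃c₀ after ∀ρ; supersedes the body of stmt-14702) — VIOLATION GAP, K-UNIFORM UP TO THE CAP: for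
every repulsive finite-range v there are K₀ and ρ₀ > 0 such that for every 0 < ρ < ρ₀ there is c₀ =
c₀(ρ) > 0 with: for all large N (threshold after ρ, before K), EVERY K₀ ≤ K ≤ log N (and 3ℓ ≤ L; a =
scattering length, ℓ = K(ρa)^(-1/2), L = (N/ρ)^(1/3)), every interior cell Q = x₀ + [0,ℓ)³ (ℓ ≤ x₀ₖ,
x₀ₖ + 2ℓ ≤ L) and every 1 ≤ M ≤ √(ρℓ³): every Dirichlet trial state Φ that vanishes on {|N_Q − ρℓ³|
≤ M√(ρℓ³)} has energy ≥ E₀(N, L) + c₀·a·ρ·M². Bulk expectation Δ²/(2χ_Q) = 4πaρM², χ_Q ≈ ℓ³/(8πa),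
K-free; c₀(ρ) must also serve the wall-adjacent cells at K near K₀, whose GP mean count sits R(K,ρ)
= 0.56K^(1/2)e^(−7.09K)(ρa³)^(−1/4) window units below the nominal centre (R ≪ 1 at every physical
ρ, → ∞ only formally as ρ → 0 — why c₀ follows ρ); a = 0 vacuous; implies the restated support
CountViolationGap (Sketch.lean `countViolationGap'_of_U'`). [difficulty: XL] (why it might fail: an
N-uniform O(aρM²) increment above E₀, itself known only to LHY precision, no local surgery argument
in print; c₀(ρ) has to hold uniformly over K ≤ log N, all interior cells and M up to the
void/overfull corner M = √n̄ with hard cores; any violation family with o(1) excess at K ≤ log N,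
fixed ρ, kills it.) [LSSY2005, FournaisSolovej2020, Junge2026, ChongLiangNam2026,
PitaevskiiStringari1991, FournaisEtAl2024, PethickSmith2008]
#4 CellCountTailsU (crux; RESTATED 2026-08-16 in repair #2 = refuter rattack-14703's C′ verbatim;
supersedes the body of stmt-14703) — CELL-COUNT TAILS, K-UNIFORM UP TO THE CAP: for every repulsive
finite-range v there are K₀ and ρ₀ > 0 such that for every 0 < ρ < ρ₀ there are C and c₁ > 0
(depending on ρ) with: for all large N, EVERY K₀ ≤ K ≤ log N (3ℓ ≤ L), some δ > 0, every
δ-near-minimiser Ψ of the Dirichlet energy (box side L = (N/ρ)^(1/3)), every interior cell Q of side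
ℓ = K(ρa)^(-1/2) and every 1 ≤ M ≤ √(ρℓ³): ∫_{|N_Q − ρℓ³| > M√(ρℓ³)} |Ψ|² ≤ C·e^(−c₁M²). At fixed
(ρ, K) the M-range is bounded, so the whole content is the uniformity of C, c₁ and of the
N-threshold over K ≤ log N — exactly what the transfer consumes at K = K(N) ≍ ((2/c₁)(ρa³)^(1/2) log
N)^(1/3), M(N)² = (2/c₁) log N ≤ n̄(N): union bound over n_c ≤ N interior cells ⇒ π(all cells in
window) ≥ 1 − C(ρ)/N → 1. Under the cap the wall-layer drift of E N_Q is ≲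
1.7K^(3/2)(ρa³)^(−5/12)N^(−1/3) → 0 window units at central cells and ≤ R(K₀,ρ), N-independent, at
wall-adjacent ones (absorbed by C(ρ) ≍ e^(4c₁R²)); larger cells only help (Var N_Q ≍ n̄ξ/ℓ·log =
O(n̄ log K/K), AstrakharchikCombescotPitaevskii2007; emptying a cell costs action ≍ n̄K); implies
the restated support CellCountTails (Sketch.lean `cellCountTails'_of_U'`). [difficulty: L] (why it
might fail: no concentration beyond the variance for N_Q under Ψ₀² in print (sum rules + Chebyshev;
LDP only in mean field, Rademacher2024 Thm 1.1; no LSI); e^(−c₁M²) up to voids M = √n̄ with C, c₁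
uniform in K ≤ log N — an N-dependent drift of E N_Q ≳ √n̄ inside the cap or heavy void tails would
still kill it.) [Rademacher2024, ReattoChester1967, PitaevskiiStringari1991,
AstrakharchikCombescotPitaevskii2007, LSSY2005, PethickSmith2008, Fournais2020]
#4 CellCondensationGrowing (crux, NEW 2026-08-16, co-ranked 4: it must render before the transfer
that quotes it; the input the refuters asked for) — LOCAL CONDENSATION AT LOGARITHMIC MESOSCALE: for
every repulsive finite-range v there are K₀, c > 0, ρ₀ > 0 with: for 0 < ρ < ρ₀, all large N, some δ
> 0, every δ-near-minimiser Ψ (box side L = (N/ρ)^(1/3)), every K₀ ≤ K ≤ log N and every interior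
cell Q = x₀ + [0,ℓ)³ of side ℓ = K(ρa)^(-1/2): ⟨u_Q, γ_Ψ u_Q⟩ ≥ c·ρℓ³ for the flat cell mode u_Q =
ℓ^(−3/2)·1_Q. The cap log N dominates the needed K(N) ≍ C(v,ρ)(log N)^(1/3) for every constant and
stays ≪ (ρa)^(1/2)L/3 (which would restate X_B1); partial condensation c > 0 suffices (fraction
variation across cells = Λ-bounded inhomogeneity for the engine); a = 0 vacuous. [difficulty:
open-problem] (why it might fail: it IS condensation at a divergent (poly-log) scale at fixed ρ —
open; energy localisation provably stalls at N-independent ℓ (depletion ≲ ℓ²·(energy error per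
particle), Barriers.KineticGapLengthScales: LSSY2005 Thm 5.1, Fournais2020 Thm 1.2, FournaisEtAl2024
Thm 1.3, Junge2026 Cor. 6 all N-independent), so it needs a ground-state-specific tool (Ψ₀ > 0,
eigenvalue equation, sum rules) nobody has.) [LSSY2005, Fournais2020, Junge2026, FournaisEtAl2024,
BrenneckeEtAl2024, ChongLiangNam2026, AdhikariBrenneckeSchlein2020]
#5 CensoredTransfer (crux, RESTATED 1:1 2026-08-16 over the new inputs; supersedes the body of
stmt-14636) — THE BET of card censor-dont-project-mmatrix-flow = the refuters' C′₁ (ranked last: a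
material implication over the rank-2–4 decls, least directly attackable — staff the typed inputs
first): VillainCurrentLRO → CellCountTailsU → CountViolationGapU → CellCondensationGrowing →
ZeroModeOccupation (X_B1 BY NAME). Intended proof (full text in the item docstring): (o) v a.e.
zero: FreeGasZeroMode; else a ∈ (0,∞) (ScatteringLengthPos); choose K(N) := max(K₀,
((2/c₁)(ρa³)^(1/2) log N)^(1/3)) ≤ log N, M(N)² := (2/c₁) log N ≤ n̄(N); (i) Doob-transform Ψ₀ and
censor (trace, ChenFukushima2011 Ch. 5 / Meyer1989) its diffusion onto P = {all interior cells of
side ℓ(N) in window}, π(P) ≥ 1 − C/N (CellCountTailsU + union bound), traced form positive with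
ground state Ψ₀|P exactly (StoquasticSchurComplement); (ii) K1: exits globally rare (≲
(C/N)·M²·√(8π)K per slab → 0) and short (CountViolationGapU: rate ≥ c₀aρM², duration ≍ ξ²/M² ≪ τ₀ ≍
ℓξ) ⇒ jump kernel = Σ_cells local positive pieces; (iii) push forward under (cell counts, face
crossings) per slab τ₀: a POSITIVE (3+1)-D current law = Villain at stiffness ≍
(8π)^(-1/2)K(N)²(ρa³)^(-1/2) → ∞ with Λ-bounded inhomogeneity (in-cell coherence from
CellCondensationGrowing) × a quasi-local positive perturbation of vanishing mass; (iv) engine ⇒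
equal-time worm LRO ⇒ interior block coherence ⇒ (Ψ₀ ≥ 0; wall layer and Pᶜ carry o(N)) ⟨φ₀, γ φ₀⟩ ≥
cN, transferred to δ-near-minimisers by compactness at fixed (N, L). [deps: VillainCurrentLRO,
CellCountTailsU, CountViolationGapU, CellCondensationGrowing; lemmas: FreeGasZeroMode,
ScatteringLengthPos, StoquasticSchurComplement] [difficulty: open-problem] (why it might fail: even
with cells growing like (log N)^(1/3) and exits globally rare, re-entry need not split into
cell-local positive jumps (K1: all particles diffuse meanwhile; exits live on a UNION of single-cell
violation sets), and the delivered law is Villain only up to quasi-local factors with memory, free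
boundary, N-dependent stiffness.) [Meyer1989, ChenFukushima2011, BermanPlemmons1994,
AizenmanEtAl2021, BFKT2017, Benfatto1994, LSSY2005, FrohlichSpencerCMP1982, Junge2026]
#9 CountViolationGap (support; crux #3 until 2026-08-16; RESTATED 2026-08-16 in repair #2 to the
fixed-K corollary of the repaired U item: ∃K₀ ρ₀ ∀ρ ∃c₀(ρ) ∀K ≥ K₀ ∀ᶠN … same body — N-threshold
after K, no cap needed) — milestone (the gap at one cell scale, K-uniform constant) and refutation
proxy (¬CountViolationGap ⇒ ¬CountViolationGapU); the vetted stmt-11475 (c₀ before ρ, ρ₀ after K) is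
incomparable and formally bitten by the ρ → 0 wall-cell deficit, hence superseded. [difficulty: XL]
[LSSY2005, FournaisSolovej2020, Junge2026, PethickSmith2008]
#9 CellCountTails (support; crux #4 until 2026-08-16; RESTATED likewise: ∃K₀ ρ₀ ∀ρ ∃C c₁ ∀K ≥ K₀ ∀ᶠN
… same body) — milestone and refutation proxy (¬CellCountTails ⇒ ¬CellCountTailsU); supersedes the
vetted stmt-11476, which rattack-14703's witness (ii) bites for the same reason. [difficulty: L]
[Rademacher2024, ReattoChester1967, LSSY2005, PethickSmith2008]
#9 HomogeneousVillainLRO (support) — (= stmt-3528) milestone 0 of the engine, the Λ = 1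
translation-invariant case; closest to print (FrohlichSpencerCMP1982, Guth1980). [difficulty: L]
[FrohlichSpencerCMP1982, Guth1980, KennedyKing1986]
#9 FreeGasZeroMode (support) — (= stmt-8912, shared) the free branch of CensoredTransfer (lemma for
its prover, not a hypothesis of `closes`): v a.e. zero on (0,∞) ⇒ free Dirichlet gas, E₀ = 3Nπ²/L²,
gap 3π²/L², ⟨φ₀, γ φ₀⟩ ≥ ((8/π²)³ − O(η))N ≥ N/4 for δ ≤ η²·3π²/L². [difficulty: M] [LSSY2005]
#9 ScatteringLengthPos (support) — for every repulsive finite-range v: a < ∞, and a > 0 unless v is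
a.e. zero on (0,∞) (GNS inequality on 1 − φ_n). [difficulty: provable-now] [LSSY2005]
#9 StoquasticSchurComplement (support) — card P1: for a real symmetric PSD Z-matrix A with ker A =
ℝψ, ψ > 0, and a proper index split P ⊔ Q: A_QQ ≻ 0 with A_QQ⁻¹ ≥ 0 entrywise, the Schur complement
onto P is a PSD Z-matrix with kernel ℝ·ψ|_P, and ψ|_Q = −A_QQ⁻¹A_QPψ|_P (Crabtree–Haynsworth /
Meyer's stochastic complement); provable now over Literature.LinearAlgebra.Matrix.IsZMatrix.
[difficulty: M] [Meyer1989, BermanPlemmons1994, DorflerBullo2013, BravyiEtAl2008]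

TWO-LAYER PLAN. Foreseen glued splits (none filed; k ≤ 3, depth 1): CensoredTransfer ⇐
CensoredKernelLocality (K1 typed once the censored-form
vocabulary exists: at K(N), M(N) the traced form on P = form on P + Σ_cells positive jump kernels
with e^(−κ·dist/ℓ) tails, total intensity
per slab → 0) → EngineDeliveredClass (VillainCurrentLRO widened to free boundary, N-dependent
stiffness floor and quasi-local positive
perturbations |u_b(J)| ≤ ε(1 + J²/κ_b); NOT an n-dependent Villain sandwich — negatives
BerryStiffPhaseLRO) → BlockToZeroMode (block coherence
at scale ℓ(N) ⇒ ⟨φ₀, γ φ₀⟩ ≥ cN: Ψ₀ ≥ 0, Cauchy–Schwarz on the wall layer and on Pᶜ, compactness at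
fixed (N, L)) → CensoredTransfer.
VillainCurrentLRO ⇐ HomogeneousVillainLRO (filed) → InhomogeneityByDuality → VillainCurrentLRO.
CountViolationGapU ⇐ CountViolationGap (filed,
restated fixed-K form: N-threshold after K) → uniformity of the N-threshold over K ≤ log N (the
surgery acts in a K-free neighbourhood of ∂Q;
the interior-excess drift ≲ 1.7K^(3/2)(ρa³)^(−5/12)N^(−1/3) is the only K-growing enemy);
CellCountTailsU ⇐ CellCountTails (filed, restated)
→ the same threshold uniformity for the tails.

KILL CRITERIA. CountViolationGap or CountViolationGapU refuted by an explicit family of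
violation-supported Dirichlet trial states with excess energy o(1) as
N → ∞ (no N-uniform excursion rate) ⇒ the censoring bookkeeping has no local clock: close
`refuted:CountViolationGapU` unless the witness only
shows a smaller N-uniform rate (misstated ⇒ file the rate it shows; CensoredTransfer tolerates any
N-uniform, K-uniform rate with gap·τ₀ ≳ 1)
or only breaks K-uniformity at cells comparable to L (misstated ⇒ cap K ≤ log N — APPLIED 2026-08-16
to both U items together with
ρ-dependent constants against the ρ → 0 wall-cell deficit; a killing witness must now live at fixed
ρ inside K ≤ log N: an N-dependent drift
of E N_Q of order √n̄ there, or an o(1)-excess violation family there; a window recentred at E_Ψ₀N_Q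
is the remaining misstated-type repair).
CellCountTails(U) refuted inside 1 ≤ M ≤ √n̄ (heavier than Gaussian, N-uniformly) ⇒ restate with the
true tail if n_c × tail(M(N)) is still
summable for some admissible M(N) ≤ √n̄(N) with K(N) ≤ log N (stretched-exponential e^(−cM^α), α >
0, suffices: K(N)³ ≍ (log N)^(2/α)), else close.
CellCondensationGrowing refuted (a family of near-minimisers with a decondensed interior cell of
side ≤ (log N)(ρa)^(−1/2)) ⇒ the growing-cell
mechanism is dead: pivot to the refuters' C′₂ as a NEW superseding route (fixed cells inside the
proved condensation window, positive
space-time DEFECT expansion instead of all-cells censoring, new Literature-grade engine "Villain LRO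
uniform over a Bernoulli-dominated dilute
defect field" — not reachable from VillainCurrentLRO by AHPS monotonicity since defects lower κ —
plus JOINT multi-cell tails) or close
`refuted:CellCondensationGrowing`; the same pivot if a refuter grades CellCondensationGrowing as
target-restating. VillainCurrentLRO refuted
by an inhomogeneous stiffness field ⇒ shared pivot with vortex-sheet-duality: HomogeneousVillainLRO
+ the homogeneity the gas has (Λ = 1 + o(1)).
CensoredTransfer (an implication ending in X_B1) cannot be refuted short of ¬BEC; it is ABANDONED
(close exhausted / superseded) if the
trimer test exhibits O(1) non-local censored couplings not decaying in M. X_B1 (0686) or PeriodicBEC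
+ BoundaryTransferWeak proved by any
route moots this one.

NOT DECOMPOSED YET. Everything inside CensoredTransfer: the censored/trace-form and current
push-forward VOCABULARY (definition requests below; carriers:
GroundStateFeynmanKac*.lean, GroundState.lean), K1 as a typed statement, the partition of the exit
set Pᶜ = ⋃_Q V_Q into single-cell pieces (the part-form bottom of a
UNION is ≤ the minimum over cells: an IMS-type localisation in the smoothed count variables with
K-free error is part of the K1 child, as
the gen-1 refuter noted), the engine widening to free spatial boundary + N-dependent stiffness +
quasi-local positive perturbations, the
wall layer and the mass outside P (o(N)), ground state ↔ δ-near-minimisers at fixed (N, L)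
(compactness, uniqueness for hard cores),
a(v) ∈ (0, ∞) (ScatteringLengthPos filed as support), and the bookkeeping of the choices K(N), M(N)
(made inside the transfer proof from
the constants c₁, K₀ of the inputs — the items quantify ∀K so that no item depends on another's
constants). U2 of the card (exact
Perron–Frobenius real-space RG by iterated censoring) stays a programme, not an item. How
CellCondensationGrowing might be proved is deliberately NOT planned
(it is a crux because no technique reaches it; candidate levers = KineticGapLengthScalesNarrow's
"NOT bound" clause: Ψ₀ > 0 + repulsion,
the eigenvalue equation, second variation, sum rules). Positive temperature and the periodic twin
(BoundaryTransferWeak 0827) are out of scope.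

CHEAPEST FALSIFIER. (a) The refuters' Kac/union-bound arithmetic, redone for the repaired scales: at
K(N), M(N) the all-cells window set has mass ≥ 1 − C/N and
the expected number of exits per Josephson slab is ≲ (C/N)·M(N)²·√(8π)K(N) → 0, so the gen-1/gen-2
witness no longer applies; a refuter should
first re-check that the U items' quantifiers license K = K(N) (ρ₀, C(ρ), c₁(ρ), c₀(ρ) and the
N-threshold precede ∀K; 3ℓ(N) ≤ L
eventually) and log N ≥ K(N). (a′) Wall-layer arithmetic for the capped items (rattack-14703
calc_wall_shift.txt, redone in NUMBERS):
central-cell drift s ≲ 1.7K^(3/2)(ρa³)^(−5/12)N^(−1/3) → 0 under K ≤ log N; wall-adjacent deficit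
R(K,ρ) = 0.56K^(1/2)e^(−7.09K)(ρa³)^(−1/4)
window units, maximal at K₀ and N-independent ⇒ absorbed by C(ρ), c₀(ρ); a refuter should look for
any OTHER N-growing drift of E N_Q that
survives the cap (edge/corner layers are subleading to faces; finite-N bulk-density corrections are
O(ξ/L)).
(b) The card's trimer test (kit py, hours; not run — hub compute-free): Bose–Hubbard trimer, n̄ =
30–100 per site, U·n̄/J ≪ 1; censor the
MIDDLE site's window violations |n₂ − n̄| > M√n̄ by the exact sparse Schur complement of A = H − E₀,
Doob-transform, and read off (i) the
total censored jump intensity versus M (prediction ≤ C·M²·e^(−cM²)); (ii) the induced DIRECT site-1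
↔ site-3 rate relative to the
nearest-neighbour one — an O(1) ratio not decaying in M kills K1, hence CensoredTransfer; (iii) the
bottom of A on the violation block
against c₀·U·M²; (iv, new) 5–7 sites at fixed M: the intensity should scale linearly in the number
of cells (the n_c·p law behind the repair).
(c) Lookup for CellCondensationGrowing: no printed condensation statement at fixed ρ reaches a scale
growing with N (LSSY2005 Thm 5.1,
Fournais2020 Thm 1.2, FournaisEtAl2024 Thm 1.3, Junge2026 Cor. 6, BrenneckeEtAl2024 Thm 1: all
N-independent) — a genuine crux, not a citation.

NUMBERS. Units ħ = 2m = 1; a = scattering length; ξ = (8πρa)^(−1/2); ℓ = K(ρa)^(−1/2) = √(8π)·K·ξ;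
n̄ = ρℓ³ = K³(ρa³)^(−1/2). Repaired
scales (given c₁, C from CellCountTailsU and the K₀'s): M(N)² = (2/c₁) log N; K(N) = max(K₀,
((2/c₁)(ρa³)^(1/2) log N)^(1/3)) so that
M(N)² ≤ n̄(N); n_c ≤ N interior cells ⇒ 1 − π(P) ≤ N·C·e^(−c₁M²) = C/N; K(N) ≤ log N and 3ℓ(N) ≤ L =
(N/ρ)^(1/3) for all large N;
ℓ(N)/ℓ_Fournais, ℓ(N)/ℓ_Junge → ∞ (slowly): the cells LEAVE every proved condensation window — hence
CellCondensationGrowing. Example ρa³ = 10⁻⁶, c₁ = 0.38, K₀ = 4: K(N) = K₀ until log N ≈ 1.2·10⁴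
(only M grows for every physical N). Wall layer (repair #2): GP profile ψ₀tanh(d/√2ξ), displaced
thickness ∫sech² = √2ξ per face, D ≈ 6√2ξρL² = Θ(N^(2/3)) particles,
interior excess 6√2ξ/L relative; drift in window units s = 6√2·√n̄·ξ/L =
1.69K^(3/2)(ρa³)^(−5/12)N^(−1/3) (ℓ = L/3 uncapped: s ≍ N^(1/6), the
refuters' 32.6/103/326 at N = 10⁶/10⁹/10¹² for ρa³ = 10⁻⁶; capped, K = K₀ = 4: s = 4272·N^(−1/3) < 1
beyond N ≈ 8·10¹⁰; K = log N: s → 0 like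
(log N)^(3/2)N^(−1/3)); wall-adjacent cell (d ∈ [ℓ,2ℓ]): relative deficit b(K) = (2√2ξ/ℓ)e^(−√2ℓ/ξ)
= (0.564/K)e^(−7.09K) (ℓ/ξ = √(8π)K),
R(K,ρ) = b√n̄ = 0.564K^(1/2)e^(−7.09K)(ρa³)^(−1/4): 5·10⁻¹³·(ρa³)^(−1/4) at K = 4, i.e. R > 1 only
for ρa³ ≲ 10⁻⁴⁹. Gap: χ_Q = ℓ³/(8πa) ⇒ Δ²/(2χ_Q) = 4πaρM² at
Δ = M√n̄, so bulk c₀ ∈ (0, 4π), K-free; c₀(ρ) ≤ bulk value, smaller only through wall cells at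
unphysically small ρ. Tails: Var N_Q = O(n̄/K); free binomial reference e^(−M²/2) (M ≪ √n̄),
e^(−0.386n̄) at M = √n̄. Coarse model: E_J ≍ ρℓ, E_C ≍ 8πa/ℓ³, slab τ₀ = (E_J E_C)^(−1/2) ≍ ℓξ,
stiffness √(E_J/E_C) ≍ (8π)^(−1/2)K²(ρa³)^(−1/2) → ∞; excursion
duration/τ₀ ≍ 2/(√(8π)KM²) ≪ 1; censored intensity per cell per slab ≲ C e^(−c₁M²)·M²·√(8π)K/2,
total per slab ≲ (C/N)·M²·√(8π)K/2 → 0. Items: 13 (1 target; 5 cruxes ranked VillainCurrentLRO 2,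
CountViolationGapU 3, CellCountTailsU 4,
CellCondensationGrowing 4, CensoredTransfer 5; 6 support; 1 assembly); 10 at open, 11/10 after the
badge/glue repairs, 13 after repair #1;
repair #2 restated four bodies 1:1 (CountViolationGapU, CellCountTailsU, CountViolationGap,
CellCountTails; names, kinds, ranks kept, count
unchanged); the superseded bodies (stmt-14636, 14702, 14703, 11475, 11476) survive in the file
history and the refuters' evidence.

DEFINITION REQUESTS. (1) CensoredDirichletForm / traceForm (topic Literature/Probability/Process or
MathematicalPhysics/QuantumManyBody): for a weight Ψ on
Config N and a configuration set P, E^P(f,f) = inf{∫|∇g|²|Ψ|² : g = f on P} with its Beurling–Deny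
decomposition (strongly local part on
P + jump kernel = Feller measure of excursions through Pᶜ), ChenFukushima2011 Ch. 5 — needed to type
CensoredKernelLocality (K1); both
refuter generations flag that K1 cannot be vetted until this exists. (2) Matrix.schurComplementOn
next to Literature.LinearAlgebra.Matrix.IsZMatrix. (3) Cite facts wanted: Junge2026 Cor. 6 /
FournaisEtAl2024 Thm 1.3 Neumann-cell condensation
(Junge2026_neumannBox_pinnedLowerBound exists; the larger-box corollary does not) — the nearest
printed neighbours of
CellCondensationGrowing. Filed informally; workitems are added if a grounder asks.

Novelty: Searches (2026-08-15, plancard seat): `lit galaxy search --star all` for "stochastic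
complementation" (13 rows: Stewart's Numerical
Solution of Markov Chains, Langville–Meyer, queueing/performance books — no physics), "Kron
reduction" (16 rows: power-systems texts,
DorflerBullo2013's area), "stoquastic" (16 rows: QMC/annealing books, no Schur-complement
coarse-graining), "Feller measure" (6 rows:
ChenFukushima2011 located, Demuth preprints); `lit frontier AtomisticToContinuum --since 2023` (30
rows; Bose descendants
arXiv:2510.20493 kinetic localisation via Poincaré-type inequalities, arXiv:2603.20776 Junge2026,
arXiv:2602.16566, arXiv:2605.06844 —
none censors or traces a ground-state process); `lit bridges AtomisticToContinuum --cross any` (30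
rows, no Markov-aggregation bridge);
`lit search` / `lit search --hybrid` ×4 — searchd unavailable (rc 75) that session; `ledger
negatives`; grep of the 83 route files of this
sub for censor/Schur/M-matrix/stochastic complement/trace Dirichlet/Feshbach (7 files, all CLOSED,
all mode-level Feshbach–Schur); plus the
card's own log and the triage-22 refuter audit (Kron reduction, graph-transformation, Simon–Ando
aggregation, AMG, BDLT gadgets, CORE named as
"X in a costume" candidates — all outside many-body ground states or perturbative). Route-repair
2026-08-16 (this seat): `lit search`
"Bose–Einstein condensation dilute Bose gas length scales beyond Gross–Pitaevskii local condensation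
boxes" (local FTS unavailable, OpenAlex/S2
rate-li  [refs: 10.1137/1031050, 2510.20493, 2603.20776, 2602.16566, 2605.06844, 0803.2686, 1605.02353, doi:10.1137/1031050, DorflerBullo2013, ChenFukushima2011, Junge2026, LSSY2005, Fournais2020, FournaisEtAl2024, BrenneckeEtAl2024, ChongLiangNam2026, Meyer1989, BermanPlemmons1994, BravyiEtAl2008, KyngSachdeva2016, BFKT2017, FrohlichSpencerCMP1982]

Barriers (technique_class: censoring, schur-complement, coarse-graining, duality): - technique_class: censoring, schur-complement, coarse-graining, duality
- Literature.Barriers.AtomisticToContinuum.BogoliubovPerturbationInfrared: evaded at the step its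
sources single out (Benfatto1994: complex instead of positive Gaussian measures; BFKT2017: large
fields) — nothing is expanded around Bogoliubov, large fields are removed by censoring with positive
exact bookkeeping; NOT evaded for the infrared endgame, which is the (3+1)-D Villain engine (duality
+ Peierls, expansion parameter the sheet fugacity e^(−cK_stiff), not a loop expansion) — conceded
and shared with vortex-sheet-duality.
- Literature.Barriers.AtomisticToContinuum.KineticGapLengthScales: IT DOES APPLY after the
2026-08-16 repair and is CONCEDED, not evaded: the refuters showed that all-cells censoring needs
cells of side ℓ(N) = K(N)(ρa)^(−1/2) with K(N) ≍ (log N)^(1/3) → ∞, which leaves every proved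
condensation window (LSSY2005 Thm 5.1, Fournais2020 Thm 1.2, FournaisEtAl2024 Thm 1.3, Junge2026
Cor. 6 — all N-independent at fixed ρ), so the in-cell coherence is now the explicit crux
CellCondensationGrowing (local condensation up to K ≤ log N). The bet is (i) that this is a strictly
weaker target than X_B1 (poly-log versus N^(1/3): the route is an exponential scale reduction, and
the cap log N keeps it from restating the target) and (ii) that it is a ground-state statement (∃δ
after N: infinitesimal window), hence outside the ENERGY-WINDOW class the narrowed block
KineticGapLengthScalesNarrow binds b

History (route lifecycle, newest last):
- 2026-08-16T04:06:16Z · rev 8: restated CensoredTransfer (stmt-AtomisticToContinuum-11477) — route-repair (glue, gen 2; stamp glue.non-crux-hypothesis: `closes` assumed the SUPPORT item FreeGasZeroMode = stmt-8912). Fix = fold the free-gas branch into t (planner-rbadge-AtomisticToContinuum-BECStoquas-4c40e568-g2-0)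
- 2026-08-16T04:06:16Z · rev 8: dropped ZeroModeFromCensoring — route-repair (glue, gen 2; stamp glue.non-crux-hypothesis: `closes` assumed the SUPPORT item FreeGasZeroMode = stmt-8912). Fix = fold the free-gas branch into t (planner-rbadge-AtomisticToContinuum-BECStoquas-4c40e568-g2-0)
- 2026-08-16T04:10:52Z · rev 9: restated Assembly (stmt-AtomisticToContinuum-11481) — route-repair (glue, gen 2) step 2: restate the Assembly item 1:1 to the four-crux chain `VillainCurrentLRO → CellCountTails → CountViolationGap → CensoredTransf (planner-rbadge-AtomisticToContinuum-BECStoquas-4c40e568-g2-0)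
- 2026-08-16T06:12:30Z · rev 11: restated Assembly (stmt-AtomisticToContinuum-14638), CensoredTransfer (stmt-AtomisticToContinuum-14636) — STEP 2/3 — route-repair (refuted-misstated CensoredTransfer stmt-14636): RESTATE CensoredTransfer 1:1 (same name/kind/rank) to `VillainCurrentLRO → CellCountTai (planner-rrefute-AtomisticToContinuum-BECStoqua-5bd4c337-0)
- 2026-08-16T06:57:05Z · rev 13: restated CellCountTailsU (stmt-AtomisticToContinuum-14703), CountViolationGapU (stmt-AtomisticToContinuum-14702), CellCountTails (stmt-AtomisticToContinuum-11476), CountViolationGap (stmt-AtomisticToContinuum-11475) — route-repair #2 (refuted-MISSTATED CellCountTailsU stmt-14703; unit rrefute-AtomisticToContinu (planner-rrefute-AtomisticToContinuum-BECStoqua-bda991a0-0)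
- 2026-08-25T13:23:57Z · DORMANT — reconciler: no traction for 7.7 d (last activity item-evidence-added at 2026-08-17T19:15:47Z); parked, not closed — `ledger route dormant route-AtomisticToConti (operator:999:1788026)

sub-problem: BoseEinsteinCondensation · status: dormant · opened planner-plancard-AtomisticToContinuum-BoseEin-40212e83-0 2026-08-15T18:10:18Z · rev 13 · ledger route-AtomisticToContinuum-BECStoquasticCensoring
GENERATED by the gate from the ledger (D-0016/17). Provers cite these decls: `theorem foo : Summit.AtomisticToContinuum.BoseEinsteinCondensation.Theses.BECStoquasticCensoring.<Decl> := …` in Summits/AtomisticToContinuum/BoseEinsteinCondensation/Theorems/<Name>.lean.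
-/

namespace Summit.AtomisticToContinuum.BoseEinsteinCondensation.Theses.BECStoquasticCensoring

open scoped BigOperators Topology Manifold Classical MeasureTheory ProbabilityTheory Matrix InnerProductSpace ComplexConjugate ContinuousMap
open Filter Set Function TopologicalSpace MeasureTheory

attribute [summit_statement] _root_.BoseEinsteinCondensation

/-- item stmt-AtomisticToContinuum-0686 · target · rank 0 · open · by planner
why it might fail: Thermodynamic-limit BEC itself in zero-mode Dirichlet form (LSSY2005 Ch. 5 (5.2), open), uniform over ALL δ-near-minimisers: fails if Dirichlet near-minimisers condense into a mode asymptotically orthogonal to the flat φ₀ or fragment; condensation proved only to length (ρa)^-½(ρa³)^-(¼+η), Junge2026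
sources: LSSY2005, PenroseOnsager1956, Fournais2020, Junge2026
X_B1: zero-mode macroscopic occupation. For every repulsive finite-range v, at all small densities
ρ, for all large N there is δ > 0 such that every δ-near-minimiser Ψ of the Dirichlet N-body energy
in the box of side (N/ρ)^{1/3} has ⟨φ₀, γ_Ψ φ₀⟩ ≥ cN for the normalised constant mode φ₀ =
L^{-3/2}·1_box (c > 0 depending on v, ρ). -/
@[route_item "route-AtomisticToContinuum-BECStoquasticCensoring"]
def ZeroModeOccupation : Prop :=
  ∀ v : ℝ → ENNReal, Literature.MathematicalPhysics.QuantumManyBody.BoseGas.IsRepulsiveFiniteRange v → ∃ ρ₀ : ℝ, 0 < ρ₀ ∧ ∀ ρ : ℝ, 0 < ρ → ρ < ρ₀ → ∃ c : ℝ, 0 < c ∧ ∀ᶠ N : ℕ in Filter.atTop, ∃ δ : ENNReal, 0 < δ ∧ ∀ Ψ : Literature.MathematicalPhysics.QuantumManyBody.BoseGas.TrialState N (Literature.MathematicalPhysics.QuantumManyBody.BoseGas.sideLength ρ N), Literature.MathematicalPhysics.QuantumManyBody.BoseGas.energy v Ψ ≤ Literature.MathematicalPhysics.QuantumManyBody.BoseGas.groundStateEnergy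 v N (Literature.MathematicalPhysics.QuantumManyBody.BoseGas.sideLength ρ N) + δ → ENNReal.ofReal (c * N) ≤ Literature.MathematicalPhysics.QuantumManyBody.BoseGas.occupation N ((Literature.MathematicalPhysics.QuantumManyBody.BoseGas.box (Literature.MathematicalPhysics.QuantumManyBody.BoseGas.sideLength ρ N)).indicator fun _ => ((Real.sqrt (Literature.MathematicalPhysics.QuantumManyBody.BoseGas.sideLength ρ N ^ 3))⁻¹ : ℂ)) Ψ.ψ

/-- item stmt-AtomisticToContinuum-11474 · crux · rank 2 · open · by planner
why it might fail: Low risk, reducible: Villain two-point functions are monotone in every edge coupling (AizenmanEtAl2021 Cor 11.4), so Λ-inhomogeneity, anisotropy and time compare down to homogeneous 3-D Villain LRO at one stiffness (FrohlichSpencerCMP1982, KennedyKing1986; cf. FSS76); unprinted: odd-tori bookkeeping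
sources: AizenmanEtAl2021, DarioGarban2025, FrohlichSpencerCMP1982, KennedyKing1986, FrohlichSimonSpencer1976, GarbanSpencer2022
[crux] ENGINE (= stmt-AtomisticToContinuum-3526 verbatim, card K3 = vortex-sheet-duality B2;
Literature-grade, independent of the Bose gas): for every inhomogeneity ratio Λ ≥ 1 there are K₀, c
> 0 such that for all M, T, every direction-wise base stiffness K_i ≥ K₀ (i ∈ Fin 4) and every bond
stiffness field κ with K_i ≤ κ_(x,i) ≤ ΛK_i, the Villain integer-current model on (ℤ/(M+1))³ ×
ℤ/(T+1) (weights Π exp(−J²/(2κ)), zero divergence) satisfies Σ_(x,y) Z(δ_(x,0) − δ_(y,0)) ≥ c(M+1)⁶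
Z(0) (uniform equal-time long-range order of the worm two-point function; Z(q) an ENNReal tsum over
currents of divergence q). [difficulty: L] -/
@[route_item "route-AtomisticToContinuum-BECStoquasticCensoring", crux]
def VillainCurrentLRO : Prop :=
  ∀ Λ : ℝ, 1 ≤ Λ → ∃ K₀ c : ℝ, 0 < c ∧ ∀ (M T : ℕ) (Kd : Fin 4 → ℝ), (∀ i, K₀ ≤ Kd i) → ∀ κ : ((Fin 3 → ZMod (M + 1)) × ZMod (T + 1)) → Fin 4 → ℝ, (∀ x i, Kd i ≤ κ x i ∧ κ x i ≤ Λ * Kd i) → let Z : (((Fin 3 → ZMod (M + 1)) × ZMod (T + 1)) → ℤ) → ENNReal := fun q => ∑' J : ((Fin 3 → ZMod (M + 1)) × ZMod (T + 1)) → Fin 4 → ℤ, if (∀ x, (∑ k : Fin 3, (J x k.castSucc - J (x.1 - Pi.single k 1, x.2) k.castSucc)) + (J x (Fin.last 3) - J (x.1, x.2 - 1) (Fin.last 3)) = q x) then ∏ x, ∏ i, ENNReal.ofReal (Real.exp (-((J x i : ℝ) ^ 2 / (2 * κ x i)))) else 0; ENNReal.ofReal c * ((M + 1 : ENNReal) ^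 6) * Z 0 ≤ ∑ x : Fin 3 → ZMod (M + 1), ∑ y : Fin 3 → ZMod (M + 1), Z (fun z => (if z = (x, 0) then 1 else 0) - (if z = (y, 0) then 1 else 0))

-- earlier CountViolationGapU (stmt-AtomisticToContinuum-14702, replaced 2026-08-16T06:57:05Z -> stmt-AtomisticToContinuum-14966): retired by None — ∀ v : ℝ → ENNReal, Literature.MathematicalPhysics.QuantumManyBody.BoseGas.IsRepulsiveFiniteRange v → ∃ K₀ c₀ ρ₀ : ℝ, 0 < c₀ ∧ 0 < ρ₀ ∧ ∀ ρ : ℝ, 0 < ρ → ρ < ρ₀ → ∀ᶠ N : ℕ in Filter.atTop, ∀ K : ℝ, K₀ ≤ K → let a : ℝ := (Literature.MathematicalPhysics.Quan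
/-- item stmt-AtomisticToContinuum-14966 · crux · rank 3 · open · by planner
why it might fail: An N-uniform O(aρM²) increment above E₀ (known only to LHY precision), no local surgery argument in print; c₀(ρ) must hold over all K ≤ log N, all interior cells and M up to the void/overfull corner with hard cores — any o(1)-excess violation family at K ≤ log N, fixed ρ, kills it.
sources: LSSY2005, FournaisSolovej2020, Junge2026, ChongLiangNam2026, PitaevskiiStringari1991, FournaisEtAl2024
[crux] VIOLATION GAP, K-UNIFORM UP TO THE LOGARITHMIC CAP (route-repair #2 2026-08-16: the refuters'
repair of the refuted-misstated stmt-AtomisticToContinuum-14702 — rattack-14702 W.lean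
`CountViolationGapULog` / rattack-14713 Repair.lean `CountViolationGapLog`: cap K ≤ log N — plus ∃
c₀ AFTER ∀ ρ, this seat's extension of rattack-14703's ρ → 0 wall-cell witness to the gap item;
weakening of 14702 kernel-checked in Sketch.lean `countViolationGapU'_of_U`): for every repulsive
finite-range v there are K₀ and ρ₀ > 0 such that for every 0 < ρ < ρ₀ there is c₀ = c₀(ρ) > 0 with:
for all large N (threshold after ρ, before K), EVERY K with K₀ ≤ K ≤ log N (and 3ℓ ≤ L; a =
scattering length, ℓ = K(ρa)^(-1/2), L = (N/ρ)^(1/3)), every interior cell Q = x₀ + [0,ℓ)³ (ℓ ≤ x₀ₖ,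
x₀ₖ + 2ℓ ≤ L) and every 1 ≤ M ≤ √(ρℓ³): every Dirichlet trial state Φ vanishing on {|N_Q − ρℓ³| ≤
M√(ρℓ³)} has energy ≥ E₀(N, L) + c₀·a·ρ·M². WHAT CHANGED: (R1) the cap — uncapped, the central cell
ℓ = L/3 has its Ψ₀-mean count R ≍ N^(1/6) window units above the nominal centre (Dirichlet wall
layer pushes Θ(N^(2/3)) particles inward, PethickSmith2008 §6.4 (6.65)), so Φ := F(Ñ_Q)Ψ₀, a smooth
cutoff of the ground state away -/
@[route_item "route-AtomisticToContinuum-BECStoquasticCensoring", crux]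
def CountViolationGapU : Prop :=
  ∀ v : ℝ → ENNReal, Literature.MathematicalPhysics.QuantumManyBody.BoseGas.IsRepulsiveFiniteRange v → ∃ K₀ ρ₀ : ℝ, 0 < ρ₀ ∧ ∀ ρ : ℝ, 0 < ρ → ρ < ρ₀ → ∃ c₀ : ℝ, 0 < c₀ ∧ ∀ᶠ N : ℕ in Filter.atTop, ∀ K : ℝ, K₀ ≤ K → K ≤ Real.log N → let a : ℝ := (Literature.MathematicalPhysics.QuantumManyBody.BoseGas.scatteringLength v).toReal; let ℓ : ℝ := K * (ρ * a) ^ (-(1 / 2 : ℝ)); let L : ℝ := Literature.MathematicalPhysics.QuantumManyBody.BoseGas.sideLength ρ N; 3 * ℓ ≤ L → ∀ x₀ : EuclideanSpace ℝ (Fin 3), (∀ k, ℓ ≤ x₀ k ∧ x₀ k + 2 * ℓ ≤ L) → ∀ M : ℝ, 1 ≤ M → M ^ 2 ≤ ρ * ℓ ^ 3 → ∀ Φ : Literature.MathematicalPhysics.QuantumManyBody.BoseGas.TrialState N L, (∀ X : Literature.MathematicalPhysics.QuantumManyBody.BoseGas.Config N, |(∑ j : Fin N, ({x : EuclideanSpace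 ℝ (Fin 3) | ∀ k, x k ∈ Set.Ico (x₀ k) (x₀ k + ℓ)}).indicator (fun _ => (1 : ℝ)) (X j)) - ρ * ℓ ^ 3| ≤ M * Real.sqrt (ρ * ℓ ^ 3) → Φ.ψ X = 0) → Literature.MathematicalPhysics.QuantumManyBody.BoseGas.groundStateEnergy v N L + ENNReal.ofReal (c₀ * a * ρ * M ^ 2) ≤ Literature.MathematicalPhysics.QuantumManyBody.BoseGas.energy v Φ

/-- item stmt-AtomisticToContinuum-14704 · crux · rank 4 · open · by planner
why it might fail: It IS condensation at a divergent (poly-log) scale at fixed ρ — open; energy localisation provably stalls at N-independent ℓ (depletion ≲ ℓ²·(energy error per particle), Barriers.KineticGapLengthScales), so it needs a ground-state-specific tool (Ψ₀ > 0, eigenvalue equation, sum rules) nobody has.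
sources: LSSY2005, Fournais2020, Junge2026, FournaisEtAl2024, BrenneckeEtAl2024, ChongLiangNam2026
[crux] NEW LOAD-BEARING INPUT of the repaired line (route-repair 2026-08-16, the refuters' C′₁
`CellCondensationGrowing Kmax` with Kmax N = log N): LOCAL CONDENSATION AT LOGARITHMIC MESOSCALE.
For every repulsive finite-range v there are K₀, c > 0 and ρ₀ > 0 such that for 0 < ρ < ρ₀, all
large N, some δ > 0, every δ-near-minimiser Ψ of the Dirichlet energy in the box of side L =
(N/ρ)^(1/3), every K with K₀ ≤ K ≤ log N and every interior cell Q = x₀ + [0,ℓ)³ of side ℓ =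
K(ρa)^(-1/2) (ℓ ≤ x₀ₖ, x₀ₖ + 2ℓ ≤ L): the flat cell mode u_Q = ℓ^(−3/2)·1_Q has ⟨u_Q, γ_Ψ u_Q⟩ ≥
c·ρℓ³. It replaces the sentence 'cell condensation at ℓ ≤ ℓ_Fournais is the proved Fournais2020 /
LSSY Thm 5.1 input' of the old transfer, which the refuters showed unusable: all-cells censoring
needs cells GROWING with N (K(N)³ ≍ (2/c₁)(ρa³)^(1/2) log N; the cap log N dominates C·(log N)^(1/3)
for every constant C, and K = (ρa)^(1/2)L/3 would restate the target, so a cap ≪ N^(1/3) is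
essential), while every printed local-condensation theorem stops at an N-INDEPENDENT scale at fixed
ρ (LSSY2005 Thm 5.1: GP boxes Na/ℓ fixed; Fournais2020 Thm 1.2: ℓ ≤ C(ρa³)^(−δ)(ρa)^(−1/2);
FournaisEtAl2024 Thm 1.3 / Junge2026 Cor. 6: R ≲ -/
@[route_item "route-AtomisticToContinuum-BECStoquasticCensoring", crux]
def CellCondensationGrowing : Prop :=
  ∀ v : ℝ → ENNReal, Literature.MathematicalPhysics.QuantumManyBody.BoseGas.IsRepulsiveFiniteRange v → ∃ K₀ c ρ₀ : ℝ, 0 < c ∧ 0 < ρ₀ ∧ ∀ ρ : ℝ, 0 < ρ → ρ < ρ₀ → ∀ᶠ N : ℕ in Filter.atTop, let a : ℝ := (Literature.MathematicalPhysics.QuantumManyBody.BoseGas.scatteringLength v).toReal; let L : ℝ := Literature.MathematicalPhysics.QuantumManyBody.BoseGas.sideLength ρ N; ∃ δ : ENNReal, 0 < δ ∧ ∀ Ψ : Literature.MathematicalPhysics.QuantumManyBody.BoseGas.TrialState N L, Literature.MathematicalPhysics.QuantumManyBody.BoseGas.energy v Ψ ≤ Literature.MathematicalPhysics.QuantumManyBody.BoseGas.groundStateEnergy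 v N L + δ → ∀ K : ℝ, K₀ ≤ K → K ≤ Real.log N → let ℓ : ℝ := K * (ρ * a) ^ (-(1 / 2 : ℝ)); ∀ x₀ : EuclideanSpace ℝ (Fin 3), (∀ k, ℓ ≤ x₀ k ∧ x₀ k + 2 * ℓ ≤ L) → ENNReal.ofReal (c * ρ * ℓ ^ 3) ≤ Literature.MathematicalPhysics.QuantumManyBody.BoseGas.occupation N ({x : EuclideanSpace ℝ (Fin 3) | ∀ k, x k ∈ Set.Ico (x₀ k) (x₀ k + ℓ)}.indicator fun _ => ((Real.sqrt (ℓ ^ 3))⁻¹ : ℂ)) Ψ.ψ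

-- earlier CellCountTailsU (stmt-AtomisticToContinuum-14703, replaced 2026-08-16T06:57:05Z -> stmt-AtomisticToContinuum-14965): retired by None — ∀ v : ℝ → ENNReal, Literature.MathematicalPhysics.QuantumManyBody.BoseGas.IsRepulsiveFiniteRange v → ∃ K₀ C c₁ ρ₀ : ℝ, 0 < c₁ ∧ 0 < ρ₀ ∧ ∀ ρ : ℝ, 0 < ρ → ρ < ρ₀ → ∀ᶠ N : ℕ in Filter.atTop, ∀ K : ℝ, K₀ ≤ K → let a : ℝ := (Literature.MathematicalPhysics.Quant
/-- item stmt-AtomisticToContinuum-14965 · crux · rank 4 · open · by planner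
why it might fail: No concentration beyond the variance for N_Q under Ψ₀² in print (sum rules + Chebyshev; LDP only in mean field, Rademacher2024 Thm 1.1; no LSI); e^(−c₁M²) up to voids M = √n̄ with C, c₁ uniform in K ≤ log N — an N-dependent drift of E N_Q ≳ √n̄ inside the cap or heavy void tails would kill it.
sources: Rademacher2024, ReattoChester1967, PitaevskiiStringari1991, AstrakharchikCombescotPitaevskii2007, LSSY2005, PethickSmith2008
[crux] CELL-COUNT TAILS, K-UNIFORM UP TO THE LOGARITHMIC CAP (route-repair #2 2026-08-16 = refuter
rattack-14703's C′ for the refuted-misstated stmt-AtomisticToContinuum-14703, verbatim; weakening of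
14703 kernel-checked in this seat's Sketch.lean `cellCountTailsU'_of_U`): for every repulsive
finite-range v there are K₀ and ρ₀ > 0 such that for every 0 < ρ < ρ₀ there are C and c₁ > 0
(allowed to depend on ρ) with: for all large N, EVERY K with K₀ ≤ K ≤ log N (and 3ℓ ≤ L), some δ >
0, every δ-near-minimiser Ψ of the Dirichlet energy (box side L = (N/ρ)^(1/3)), every interior cell
Q = x₀ + [0,ℓ)³ of side ℓ = K(ρa)^(-1/2) (ℓ ≤ x₀ₖ, x₀ₖ + 2ℓ ≤ L) and every 1 ≤ M ≤ √(ρℓ³): ∫_{|N_Q −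
ρℓ³| > M√(ρℓ³)} |Ψ|² ≤ C·e^(−c₁M²). WHAT CHANGED: (R1) the cap K ≤ log N (as in
CellCondensationGrowing; CensoredTransfer only uses K(N) ≍ ((2/c₁)(ρa³)^(1/2) log N)^(1/3) ≤ log N)
— uncapped, `∀ K ≥ K₀, 3ℓ ≤ L` admitted the macroscopic central cell ℓ = L/3, whose mean count the
Dirichlet wall layer (GP profile ψ₀tanh(d/√2ξ), PethickSmith2008 §6.4 (6.65): D ≈ 6√2ξρL² =
Θ(N^(2/3)) particles pushed inward) displaces from the NOMINAL window centre ρℓ³ by s =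
1.63ξρ^(1/3)N^(1/6) → ∞ window units, while the claime -/
@[route_item "route-AtomisticToContinuum-BECStoquasticCensoring", crux]
def CellCountTailsU : Prop :=
  ∀ v : ℝ → ENNReal, Literature.MathematicalPhysics.QuantumManyBody.BoseGas.IsRepulsiveFiniteRange v → ∃ K₀ ρ₀ : ℝ, 0 < ρ₀ ∧ ∀ ρ : ℝ, 0 < ρ → ρ < ρ₀ → ∃ C c₁ : ℝ, 0 < c₁ ∧ ∀ᶠ N : ℕ in Filter.atTop, ∀ K : ℝ, K₀ ≤ K → K ≤ Real.log N → let a : ℝ := (Literature.MathematicalPhysics.QuantumManyBody.BoseGas.scatteringLength v).toReal; let ℓ : ℝ := K * (ρ * a) ^ (-(1 / 2 : ℝ)); let L : ℝ := Literature.MathematicalPhysics.QuantumManyBody.BoseGas.sideLength ρ N; 3 * ℓ ≤ L → ∃ δ : ENNReal, 0 < δ ∧ ∀ Ψ : Literature.MathematicalPhysics.QuantumManyBody.BoseGas.TrialState N L, Literature.MathematicalPhysics.QuantumManyBody.BoseGas.energy v Ψ ≤ Literature.MathematicalPhysics.QuantumManyBody.BoseGas.groundStateEnergy v N L + δ → ∀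 x₀ : EuclideanSpace ℝ (Fin 3), (∀ k, ℓ ≤ x₀ k ∧ x₀ k + 2 * ℓ ≤ L) → ∀ M : ℝ, 1 ≤ M → M ^ 2 ≤ ρ * ℓ ^ 3 → ∫⁻ X in {X : Literature.MathematicalPhysics.QuantumManyBody.BoseGas.Config N | M * Real.sqrt (ρ * ℓ ^ 3) < |(∑ j : Fin N, ({x : EuclideanSpace ℝ (Fin 3) | ∀ k, x k ∈ Set.Ico (x₀ k) (x₀ k + ℓ)}).indicator (fun _ => (1 : ℝ)) (X j)) - ρ * ℓ ^ 3|}, (‖Ψ.ψ X‖₊ : ENNReal) ^ 2 ≤ ENNReal.ofReal (C * Real.exp (-(c₁ * M ^ 2)))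

-- earlier CensoredTransfer (stmt-AtomisticToContinuum-11477, replaced 2026-08-16T04:06:16Z -> stmt-AtomisticToContinuum-14636): retired by None — VillainCurrentLRO → CellCountTails → CountViolationGap → ∀ v : ℝ → ENNReal, Literature.MathematicalPhysics.QuantumManyBody.BoseGas.IsRepulsiveFiniteRange v → ¬ (∀ᵐ r ∂(MeasureTheory.volume.restrict (Set.Ioi (0 : ℝ))), v r = 0) → ∃ ρ₀ : ℝ, 0 < ρ₀ ∧ ∀ ρ : ℝ,
-- earlier CensoredTransfer (stmt-AtomisticToContinuum-14636, replaced 2026-08-16T06:12:30Z -> stmt-AtomisticToContinuum-14713): retired by None — VillainCurrentLRO → CellCountTails → CountViolationGap → ZeroModeOccupation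
/-- item stmt-AtomisticToContinuum-14713 · crux · rank 5 · open · by planner
why it might fail: Even with growing cells and globally rare exits, re-entry need not split into cell-local positive jumps (K1: all particles diffuse meanwhile; exits live on a UNION of single-cell violation sets); the delivered law is Villain only up to quasi-local factors with memory and free boundary.
sources: Meyer1989, ChenFukushima2011, BermanPlemmons1994, AizenmanEtAl2021, BFKT2017, Benfatto1994
[crux] THE BET, RESTATED 1:1 = the refuters' repair C′₁ (route-repair 2026-08-16; supersedes the
body of stmt-AtomisticToContinuum-14636, same decl name): the engine VillainCurrentLRO, the
K-UNIFORM censoring inputs CellCountTailsU and CountViolationGapU and mesoscale local condensation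
CellCondensationGrowing imply the target X_B1 = ZeroModeOccupation BY NAME. Intended proof: (o) v
a.e. zero on (0,∞): FreeGasZeroMode verbatim (a = 0 voids H₂/H₃/CCG); otherwise a ∈ (0,∞) by
ScatteringLengthPos and, GIVEN c₁ from CellCountTailsU, choose GROWING cells K(N) := max(K₀,
((2/c₁)(ρa³)^(1/2) log N)^(1/3)) ≤ log N and window M(N)² := (2/c₁) log N ≤ n̄(N) =
K(N)³(ρa³)^(−1/2); (i) Doob-transform the nonnegative Dirichlet ground state and censor (trace,
ChenFukushima2011 Ch. 5 / Meyer1989) its diffusion onto P = {every interior cell of side ℓ(N) =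
K(N)(ρa)^(-1/2) has |N_Q − ρℓ³| ≤ M(N)√(ρℓ³)}; by CellCountTailsU and the union bound π(P) ≥ 1 − C/N
→ 1, and the traced form is positive with ground state Ψ₀|P exactly (StoquasticSchurComplement);
(ii) K1: exits from P are globally rare — total intensity per Josephson slab ≲ (C/N)·M²·√(8π)K → 0 —
and short (CountViolationGapU: rate ≥ c₀aρM², duratio -/
@[route_item "route-AtomisticToContinuum-BECStoquasticCensoring", crux]
def CensoredTransfer : Prop :=
  VillainCurrentLRO → CellCountTailsU → CountViolationGapU → CellCondensationGrowing → ZeroModeOccupation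

-- earlier CountViolationGap (stmt-AtomisticToContinuum-11475, replaced 2026-08-16T06:57:05Z -> stmt-AtomisticToContinuum-14968): retired by None — ∀ v : ℝ → ENNReal, Literature.MathematicalPhysics.QuantumManyBody.BoseGas.IsRepulsiveFiniteRange v → ∃ K₀ c₀ : ℝ, 0 < c₀ ∧ ∀ K : ℝ, K₀ ≤ K → ∃ ρ₀ : ℝ, 0 < ρ₀ ∧ ∀ ρ : ℝ, 0 < ρ → ρ < ρ₀ → ∀ᶠ N : ℕ in Filter.atTop, let a : ℝ := (Literature.MathematicalPhysic
/-- item stmt-AtomisticToContinuum-14968 · support · rank 3 · open · by planner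
why it might fail: N-uniform O(aρM²) increment above E₀, itself known only to LHY precision O(NaρY^½) (FournaisSolovej2020); Neumann/kinetic localisation (Junge2026, ChongLiangNam2026) pays errors ≫ aρM² per cell; c₀ must be K-,M-uniform from M=1 to voids M=√n̄ incl. hard cores: a K-dependent/o(aρM²) cost misstates it
sources: LSSY2005, FournaisSolovej2020, Junge2026, PethickSmith2008
[support] FIXED-K VIOLATION GAP (route-repair #2 2026-08-16: restated 1:1 to the fixed-K corollary
of the repaired CountViolationGapU — ρ₀ before K, c₀ after ρ but before K, N-threshold after K, no
cap; proved from the U item in Sketch.lean `countViolationGap'_of_U'`; supersedes the vetted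
stmt-AtomisticToContinuum-11475, whose c₀-before-ρ prefix the ρ → 0 wall-cell witness bites via the
IMS cutoff state): for every repulsive finite-range v there are K₀ and ρ₀ > 0 such that for every 0
< ρ < ρ₀ there is c₀ > 0 with: for every K ≥ K₀, all large N (threshold may depend on K), with a =
scattering length, ℓ = K(ρa)^(-1/2), L = (N/ρ)^(1/3), every interior cell Q = x₀ + [0,ℓ)³ (ℓ ≤ x₀ₖ,
x₀ₖ + 2ℓ ≤ L) and every 1 ≤ M ≤ √(ρℓ³): every Dirichlet trial state Φ vanishing on {|N_Q − ρℓ³| ≤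
M√(ρℓ³)} has energy ≥ E₀(N, L) + c₀·a·ρ·M² (part-form bottom; by the ground-state transform
⟨FΨ₀,(H−E₀)FΨ₀⟩ = ∫|∇F|²Ψ₀² a purely variational statement about the Dirichlet gas). Expected
Δ²/(2χ_Q) = 4πaρM² (1 + O(ξ/ℓ) + O(√(ρa³))); a = 0 vacuous. Role: milestone and refutation proxy
(¬CountViolationGap ⇒ ¬CountViolationGapU). [difficulty: XL] -/
@[route_item "route-AtomisticToContinuum-BECStoquasticCensoring"]
def CountViolationGap : Prop :=
  ∀ v : ℝ → ENNReal, Literature.MathematicalPhysics.QuantumManyBody.BoseGas.IsRepulsiveFiniteRange v → ∃ K₀ ρ₀ : ℝ, 0 < ρ₀ ∧ ∀ ρ : ℝ, 0 < ρ → ρ < ρ₀ → ∃ c₀ : ℝ, 0 < c₀ ∧ ∀ K : ℝ, K₀ ≤ K → ∀ᶠ N : ℕ in Filter.atTop, let a : ℝ := (Literature.MathematicalPhysics.QuantumManyBody.BoseGas.scatteringLength v).toReal; let ℓ : ℝ := K * (ρ * a) ^ (-(1 / 2 : ℝ)); let L : ℝ := Literature.MathematicalPhysics.QuantumManyBody.BoseGas.sideLength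 ρ N; ∀ x₀ : EuclideanSpace ℝ (Fin 3), (∀ k, ℓ ≤ x₀ k ∧ x₀ k + 2 * ℓ ≤ L) → ∀ M : ℝ, 1 ≤ M → M ^ 2 ≤ ρ * ℓ ^ 3 → ∀ Φ : Literature.MathematicalPhysics.QuantumManyBody.BoseGas.TrialState N L, (∀ X : Literature.MathematicalPhysics.QuantumManyBody.BoseGas.Config N, |(∑ j : Fin N, ({x : EuclideanSpace ℝ (Fin 3) | ∀ k, x k ∈ Set.Ico (x₀ k) (x₀ k + ℓ)}).indicator (fun _ => (1 : ℝ)) (X j)) - ρ * ℓ ^ 3| ≤ M * Real.sqrt (ρ * ℓ ^ 3) → Φ.ψ X = 0) → Literature.MathematicalPhysics.QuantumManyBody.BoseGas.groundStateEnergy v N L + ENNReal.ofReal (c₀ * a * ρ * M ^ 2) ≤ Literature.MathematicalPhysics.QuantumManyBody.BoseGas.energy v Φ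

-- earlier CellCountTails (stmt-AtomisticToContinuum-11476, replaced 2026-08-16T06:57:05Z -> stmt-AtomisticToContinuum-14967): retired by None — ∀ v : ℝ → ENNReal, Literature.MathematicalPhysics.QuantumManyBody.BoseGas.IsRepulsiveFiniteRange v → ∃ K₀ C c₁ : ℝ, 0 < c₁ ∧ ∀ K : ℝ, K₀ ≤ K → ∃ ρ₀ : ℝ, 0 < ρ₀ ∧ ∀ ρ : ℝ, 0 < ρ → ρ < ρ₀ → ∀ᶠ N : ℕ in Filter.atTop, let a : ℝ := (Literature.MathematicalPhysics
/-- item stmt-AtomisticToContinuum-14967 · support · rank 4 · open · by planner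
why it might fail: Needs n̄-,K-uniform sub-Gaussian concentration of cell counts under Ψ₀² beyond 2nd moments; in print: variance-level sum rules (ReattoChester1967, PitaevskiiStringari1991), large deviations of one-body sums only in the MEAN-FIELD ground state (Rademacher2024 Thm 1.1); no LSI for Ψ₀²; voids worst.
sources: Rademacher2024, ReattoChester1967, LSSY2005, PethickSmith2008
[support] FIXED-K CELL-COUNT TAILS (route-repair #2 2026-08-16: restated 1:1 to the fixed-K
corollary of the repaired CellCountTailsU — ρ₀ before K, constants C, c₁ after ρ but before K,
N-threshold after K, no cap needed; proved from the U item in Sketch.lean `cellCountTails'_of_U'`;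
supersedes the vetted stmt-AtomisticToContinuum-11476, whose constants-before-ρ prefix
rattack-14703's ρ → 0 wall-cell witness bites): for every repulsive finite-range v there are K₀ and
ρ₀ > 0 such that for every 0 < ρ < ρ₀ there are C, c₁ > 0 with: for every K ≥ K₀, all large N
(threshold may depend on K), some δ > 0, every δ-near-minimiser Ψ of the Dirichlet energy (box side
L = (N/ρ)^(1/3)), every interior cell Q of side ℓ = K(ρa)^(-1/2) and every 1 ≤ M ≤ √(ρℓ³): ∫_{|N_Q −
ρℓ³| > M√(ρℓ³)} |Ψ|² ≤ C·e^(−c₁M²). Non-trivial through K → ∞ at fixed ρ (n̄ → ∞ with C, c₁ fixed);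
at fixed K the wall-layer drift of the mean is n̄·O(ξ/L) ≪ √n̄ eventually. Role: milestone (tails at
one cell scale with K-uniform constants) and refutation proxy (¬CellCountTails ⇒ ¬CellCountTailsU).
[difficulty: L] -/
@[route_item "route-AtomisticToContinuum-BECStoquasticCensoring"]
def CellCountTails : Prop :=
  ∀ v : ℝ → ENNReal, Literature.MathematicalPhysics.QuantumManyBody.BoseGas.IsRepulsiveFiniteRange v → ∃ K₀ ρ₀ : ℝ, 0 < ρ₀ ∧ ∀ ρ : ℝ, 0 < ρ → ρ < ρ₀ → ∃ C c₁ : ℝ, 0 < c₁ ∧ ∀ K : ℝ, K₀ ≤ K → ∀ᶠ N : ℕ in Filter.atTop, let a : ℝ := (Literature.MathematicalPhysics.QuantumManyBody.BoseGas.scatteringLength v).toReal; let ℓ : ℝ := K * (ρ * a) ^ (-(1 / 2 : ℝ)); let L : ℝ := Literature.MathematicalPhysics.QuantumManyBody.BoseGas.sideLength ρ N; ∃ δ : ENNReal, 0 < δ ∧ ∀ Ψ : Literature.MathematicalPhysics.QuantumManyBody.BoseGas.TrialState N L, Literature.MathematicalPhysics.QuantumManyBody.BoseGas.energy v Ψ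 ≤ Literature.MathematicalPhysics.QuantumManyBody.BoseGas.groundStateEnergy v N L + δ → ∀ x₀ : EuclideanSpace ℝ (Fin 3), (∀ k, ℓ ≤ x₀ k ∧ x₀ k + 2 * ℓ ≤ L) → ∀ M : ℝ, 1 ≤ M → M ^ 2 ≤ ρ * ℓ ^ 3 → ∫⁻ X in {X : Literature.MathematicalPhysics.QuantumManyBody.BoseGas.Config N | M * Real.sqrt (ρ * ℓ ^ 3) < |(∑ j : Fin N, ({x : EuclideanSpace ℝ (Fin 3) | ∀ k, x k ∈ Set.Ico (x₀ k) (x₀ k + ℓ)}).indicator (fun _ => (1 : ℝ)) (X j)) - ρ * ℓ ^ 3|}, (‖Ψ.ψ X‖₊ : ENNReal) ^ 2 ≤ ENNReal.ofReal (C * Real.exp (-(c₁ * M ^ 2)))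

/-- item stmt-AtomisticToContinuum-11478 · support · rank 9 · closed · proved by Summit.AtomisticToContinuum.BoseEinsteinCondensation.Theorems.homogeneousVillainLRO_proof @ 40dd0e3ea347 (prover) · by planner
sources: FrohlichSpencerCMP1982, Guth1980, KennedyKing1986
[support] (= stmt-AtomisticToContinuum-3528 verbatim) MILESTONE 0 of the engine, the Λ = 1
translation-invariant case: direction-wise constant stiffnesses K_i ≥ K₀ give the same uniform
equal-time block long-range order; closest to print (FrohlichSpencerCMP1982 d ≥ 3 isotropic Villain,
Guth1980 dual 4-D U(1)); VillainCurrentLRO → HomogeneousVillainLRO is immediate. [difficulty: L] -/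
@[route_item "route-AtomisticToContinuum-BECStoquasticCensoring"]
def HomogeneousVillainLRO : Prop :=
  ∃ K₀ c : ℝ, 0 < c ∧ ∀ (M T : ℕ) (Kd : Fin 4 → ℝ), (∀ i, K₀ ≤ Kd i) → let Z : (((Fin 3 → ZMod (M + 1)) × ZMod (T + 1)) → ℤ) → ENNReal := fun q => ∑' J : ((Fin 3 → ZMod (M + 1)) × ZMod (T + 1)) → Fin 4 → ℤ, if (∀ x, (∑ k : Fin 3, (J x k.castSucc - J (x.1 - Pi.single k 1, x.2) k.castSucc)) + (J x (Fin.last 3) - J (x.1, x.2 - 1) (Fin.last 3)) = q x) then ∏ x, ∏ i, ENNReal.ofReal (Real.exp (-((J x i : ℝ) ^ 2 / (2 * Kd i)))) else 0; ENNReal.ofReal c * ((M + 1 : ENNReal) ^ 6) * Z 0 ≤ ∑ x : Fin 3 → ZMod (M + 1), ∑ y : Fin 3 → ZMod (M + 1), Z (fun z => (if z = (x, 0) then 1 else 0) - (if z = (y, 0) then 1 else 0))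

/-- item stmt-AtomisticToContinuum-11479 · support · rank 9 · closed · proved by Summit.AtomisticToContinuum.BoseEinsteinCondensation.Theorems.scatteringLengthPos_proof (prover) · by planner
sources: LSSY2005
[support] lemma for CensoredTransfer (its window is phrased through a = scatteringLength v): for
every repulsive finite-range v, a < ∞ (trial φ ∈ C¹ vanishing on the range ball, = 1 outside twice
it; ⊤·0 = 0), and if v is not a.e. zero on (0,∞) then a > 0 (if the scattering functional tended to
0 along φ_n, Gagliardo–Nirenberg–Sobolev for the compactly supported 1 − φ_n gives φ_n → 1 in L⁶,
contradicting ∫ min(v,1)|φ_n|² → 0 on a shell of positive measure). [difficulty: provable-now] -/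
@[route_item "route-AtomisticToContinuum-BECStoquasticCensoring"]
def ScatteringLengthPos : Prop :=
  ∀ v : ℝ → ENNReal, Literature.MathematicalPhysics.QuantumManyBody.BoseGas.IsRepulsiveFiniteRange v → Literature.MathematicalPhysics.QuantumManyBody.BoseGas.scatteringLength v ≠ ⊤ ∧ (¬ (∀ᵐ r ∂(MeasureTheory.volume.restrict (Set.Ioi (0 : ℝ))), v r = 0) → Literature.MathematicalPhysics.QuantumManyBody.BoseGas.scatteringLength v ≠ 0)

/-- item stmt-AtomisticToContinuum-11480 · support · rank 9 · closed · proved by Summit.AtomisticToContinuum.BoseEinsteinCondensation.Theorems.stoquasticSchurComplement_proof (prover) · by planner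
sources: Meyer1989, BermanPlemmons1994, DorflerBullo2013, BravyiEtAl2008
[support] card P1, the finite-dimensional positivity theorem behind "censor, don't project"
(Lynn/Crabtree–Haynsworth closure of M-matrices under Schur complement in the singular irreducible
case = Meyer's stochastic complement after the Doob transform): for a real symmetric
positive-semidefinite Z-matrix A with ker A = ℝψ, ψ > 0 entrywise (this forces irreducibility), and
any proper nonempty index set Q = {¬p} with complement P = {p}: the principal block A_QQ is positive
definite with entrywise nonnegative inverse; the Schur complement S = A_PP − A_PQ A_QQ⁻¹ A_QP is a
positive-semidefinite Z-matrix with ker S = ℝ·ψ|_P; and ψ|_Q = −A_QQ⁻¹ A_QP ψ|_P (A-harmonic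
extension). Applied to A = H − E₀ of any stoquastic (lattice-regularised) N-body Hamiltonian in the
configuration basis: configuration elimination never leaves the stoquastic cone and restricts the
ground state exactly. Provable now over Mathlib matrices with
Literature.LinearAlgebra.Matrix.IsZMatrix (InverseMMatrix.lean; its principalSubmatrix_closure is
the nonsingular twin). [difficulty: M] -/
@[route_item "route-AtomisticToContinuum-BECStoquasticCensoring"]
def StoquasticSchurComplement : Prop :=
  ∀ (n : Type) [Fintype n] [DecidableEq n] (A : Matrix n n ℝ) (ψ : n → ℝ) (p : n → Prop) [DecidablePred p], A.PosSemidef → Literature.LinearAlgebra.Matrix.IsZMatrix A → (∀ i, 0 < ψ i) → (∀ x : n → ℝ, A.mulVec x = 0 ↔ ∃ t : ℝ, x = t • ψ) → (∃ i, p i) → (∃ i, ¬ p i) → let AQQ : Matrix {i // ¬ p i} {i // ¬ p i} ℝ := A.submatrix Subtype.val Subtype.val; let APP : Matrix {i // p i} {i // p i} ℝ := A.submatrix Subtype.val Subtype.val; let APQ : Matrix {i // p i} {i // ¬ p i} ℝ := A.submatrix Subtype.val Subtype.val; let AQP : Matrix {i // ¬ p i} {i // p i} ℝ := A.submatrix Subtype.val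 Subtype.val; let S : Matrix {i // p i} {i // p i} ℝ := APP - APQ * AQQ⁻¹ * AQP; AQQ.PosDef ∧ (∀ i j, 0 ≤ AQQ⁻¹ i j) ∧ S.PosSemidef ∧ Literature.LinearAlgebra.Matrix.IsZMatrix S ∧ (∀ x : {i // p i} → ℝ, S.mulVec x = 0 ↔ ∃ t : ℝ, x = t • (fun i : {i // p i} => ψ i.1)) ∧ (fun i : {i // ¬ p i} => ψ i.1) = -((AQQ⁻¹ * AQP).mulVec (fun i : {i // p i} => ψ i.1))

/-- item stmt-AtomisticToContinuum-8912 · support · rank 9 · closed · proved by Summit.AtomisticToContinuum.BoseEinsteinCondensation.Theorems.BecFreeGas_proof @ 264277954012 (prover) · by planner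
sources: LSSY2005
[support] FREE-GAS CASE (new; refuters g12-5/g28-0 knock-on): for every repulsive finite-range v
that IS a.e. zero on (0,∞) the interaction term vanishes a.e. on configuration space (pair-distance
level sets of a null set are null), so energy = kinetic: the free Dirichlet gas. Then X_B1 for v: E₀
= 3Nπ²/L² (sharp Poincaré on (0,L)), gap 3π²/L² to the first excited level, so a δ-near-minimiser
with δ ≤ η²·3π²/L² is L²-within η of e^(iα)χ^⊗N, χ = ∏_j (2/L)^(1/2) sin(πx_j/L);
√occupation(φ₀,·)/√N is 1-Lipschitz in L², and occupation(φ₀, χ^⊗N) = N·|⟨L^(-3/2), χ⟩|² = (8/π²)³N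
≈ 0.533N, whence ⟨φ₀,γ_Ψφ₀⟩ ≥ N/4 for η small: c = 1/4, any ρ₀. Provable now; Lean-heavy (1-D
Wirtinger/Poincaré with sharp constant, tensorisation, explicit sine integrals). [difficulty: M]
[sources: LSSY2005] -/
@[route_item "route-AtomisticToContinuum-BECStoquasticCensoring"]
def FreeGasZeroMode : Prop :=
  ∀ v : ℝ → ENNReal, Literature.MathematicalPhysics.QuantumManyBody.BoseGas.IsRepulsiveFiniteRange v → (∀ᵐ r ∂(MeasureTheory.volume.restrict (Set.Ioi (0 : ℝ))), v r = 0) → ∃ ρ₀ : ℝ, 0 < ρ₀ ∧ ∀ ρ : ℝ, 0 < ρ → ρ < ρ₀ → ∃ c : ℝ, 0 < c ∧ ∀ᶠ N : ℕ in Filter.atTop, ∃ δ : ENNReal, 0 < δ ∧ ∀ Ψ : Literature.MathematicalPhysics.QuantumManyBody.BoseGas.TrialState N (Literature.MathematicalPhysics.QuantumManyBody.BoseGas.sideLength ρ N), Literature.MathematicalPhysics.QuantumManyBody.BoseGas.energy v Ψ ≤ Literature.MathematicalPhysics.QuantumManyBody.BoseGas.groundStateEnergy v N (Literature.MathematicalPhysics.QuantumManyBody.BoseGas.sideLength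 ρ N) + δ → ENNReal.ofReal (c * N) ≤ Literature.MathematicalPhysics.QuantumManyBody.BoseGas.occupation N ((Literature.MathematicalPhysics.QuantumManyBody.BoseGas.box (Literature.MathematicalPhysics.QuantumManyBody.BoseGas.sideLength ρ N)).indicator fun _ => ((Real.sqrt (Literature.MathematicalPhysics.QuantumManyBody.BoseGas.sideLength ρ N ^ 3))⁻¹ : ℂ)) Ψ.ψ

/-- `FreeGasZeroMode` holds: proved by `Summit.AtomisticToContinuum.BoseEinsteinCondensation.Theorems.BecFreeGas_proof` @ 264277954012. -/
theorem FreeGasZeroMode_holds : FreeGasZeroMode := _root_.Summit.AtomisticToContinuum.BoseEinsteinCondensation.Theorems.BecFreeGas_proof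

-- earlier Assembly (stmt-AtomisticToContinuum-11481, replaced 2026-08-16T04:10:52Z -> stmt-AtomisticToContinuum-14638): retired by None — VillainCurrentLRO → CellCountTails → CountViolationGap → CensoredTransfer → FreeGasZeroMode → _root_.BoseEinsteinCondensation
-- earlier Assembly (stmt-AtomisticToContinuum-14638, replaced 2026-08-16T06:12:30Z -> stmt-AtomisticToContinuum-14712): retired by None — VillainCurrentLRO → CellCountTails → CountViolationGap → CensoredTransfer → _root_.BoseEinsteinCondensation
/-- item stmt-AtomisticToContinuum-14712 · assembly · rank 1 · closed · proved by Summit.AtomisticToContinuum.BoseEinsteinCondensation.Theorems.becStoquasticCensoring_assembly_proof (prover) · by planner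
sources: LSSY2005, Meyer1989, FrohlichSpencerCMP1982
[assembly] VillainCurrentLRO → CellCountTailsU → CountViolationGapU → CellCondensationGrowing →
CensoredTransfer → BoseEinsteinCondensation — exactly the hypotheses and conclusion of the
re-certified deciding theorem `closes` (proof `bec_of_zeroMode (hR hE hT hG hC)`; `assemblyR_holds
:= closesR` in this seat's Sketch.lean, axioms propext/Classical.choice/Quot.sound). Route-repair
2026-08-16 (refuted-misstated CensoredTransfer stmt-14636): supersedes the four-hypothesis Assembly
stmt-AtomisticToContinuum-14638. -/
@[route_item "route-AtomisticToContinuum-BECStoquasticCensoring"]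
def Assembly : Prop :=
  VillainCurrentLRO → CellCountTailsU → CountViolationGapU → CellCondensationGrowing → CensoredTransfer → _root_.BoseEinsteinCondensation

/-! D-0027 §2.1 — DECIDING THEOREM (planner-authored via `route open/edit --closes-file`; by planner-rrefute-AtomisticToContinuum-BECStoqua-bda991a0-0 2026-08-16T06:57:05Z):
its hypotheses are this route's items and its conclusion the sub-problem Statement (glue_lint), and it elaborates with this file. -/

@[closes "route-AtomisticToContinuum-BECStoquasticCensoring"] theorem closes (hE : VillainCurrentLRO) (hT : CellCountTailsU) (hG : CountViolationGapU) (hC : CellCondensationGrowing) (hR : CensoredTransfer) : _root_.BoseEinsteinCondensation :=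
  -- route-repair #2 2026-08-16 (refuted-misstated CellCountTailsU stmt-14703 / CountViolationGapU stmt-14702, refuters' C′: cap K ≤ log N,
  -- constants after ρ): the four restated bodies keep their decl names, so the deciding theorem is unchanged — the transfer bet fed the
  -- engine, the two capped censoring inputs and mesoscale local condensation is X_B1 = ZeroModeOccupation by name; X_B1 → Statement is the
  -- proved zero-mode criterion.
  _root_.AtomisticToContinuum.BECInfraredBound.bec_of_zeroMode (hR hE hT hG hC)

end Summit.AtomisticToContinuum.BoseEinsteinCondensation.Theses.BECStoquasticCensoring
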